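import Mathlib
import HarnessLib
import Literature.NumberTheory.LFunctions.ZetaScrew
import Literature.NumberTheory.LFunctions.WeilGroundStateRealZerosProofs
import Summits.RiemannHypothesis.RiemannHypothesis.Theorems.WeilPositivityLogTwo
import Summits.RiemannHypothesis.RiemannHypothesis.Theorems.IntegerScrewWeilWindowCoerciveFloor

/-!
# Route `IntegerScrew` — an RH-FREE COERCIVE floor, uniform in `M`, on every balanced window of RATIO `4`
# of Suzuki's integer screw matrices: `(10⁻¹⁵/(4M))·Σ x_m² ≤ Σ G(log m, log m') x_m x_{m'}` for `M ≤ 4(N+1)`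

The Weil column certifies, RH-free, a POSITIVE ground energy on the two-prime window:
`EvenWinsBeyondArch.weilGroundEnergy_M72_ge : 10⁻¹⁵ ≤ ε(18/25)` (`WeilPositivityLogTwo`, from the sector
certificates at `c = 18/25`).  Through `IntegerScrewWeilWindowCoerciveFloor.screwWindow_coercive_of_coercive`
(`L²`-coercivity on `C(a)` ⟹ a floor on balanced windows of log-length `< 2a`; here `2a = 1.44 > log 4`):

* `screwWindow_coercive_ratio_four` — **for all `N, M` with `M ≤ 4(N+1)` and every real `x` with
  `Σ_{(N,M]} x_m = 0`: `(10⁻¹⁵/(4M))·Σ_{(N,M]} x_m² ≤ Σ_{(N,M]²} G(log m, log m') x_m x_{m'}`.**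

So the balanced bottom of every ratio-`4` window of every `S_M` is `≥ 2.5·10⁻¹⁶/M`, RH-FREE and UNIFORM IN
`M` — a coercive (not merely non-negative) rung at MACROSCOPIC ratio, between the tree's ratio-`1.004` floor
`(1 − log 2)/(4M)` (`IntegerScrewScrewPolyFloorWindowFloor`) and the ratio-`7` non-negativity
(`IntegerScrewWeilWindowPSD`).  LABEL: RH-FREE (a certified Weil ground-energy bound re-indexed); nothing here
bears on the truth of RH — for all ratios the statement would be RH.

References: E. Bombieri, Rend. Lincei (9) 11 (2000) §4 [Bombieri2000Weil]; M. Suzuki, J. Lond. Math. Soc.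
(2) 108 (2023), Prop. 3.1 [Suzuki2023]; the tree's certificate `Theorems/WeilPositivityLogTwo.lean`.
-/

noncomputable section

-- D-0017: `Summit.<S>.<S>.…` is the designed namespace of a single-problem summit.
set_option linter.dupNamespace false

namespace Summit.RiemannHypothesis.RiemannHypothesis.Theorems.IntegerScrew

open Literature.NumberTheory.LFunctions MeasureTheory Set Finset
open Summit.RiemannHypothesis.RiemannHypothesis.Theorems.EvenWinsBeyondArch (weilGroundEnergy_M72_ge)

/-- **RH-FREE COERCIVITY AT RATIO `4`**: for all `N, M` with `M ≤ 4(N+1)` and every real `x` balanced on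
`(N, M]`, `(10⁻¹⁵/(4M))·Σ x_m² ≤ Σ G(log m, log m') x_m x_{m'}` (the certified ground energy
`ε(18/25) ≥ 10⁻¹⁵`, `ε(a)‖F‖₂² ≤ Re Q(F)` on `C(a)`, `log 4 < 1.44`, and the coercive window floor).
[cite: Bombieri2000Weil, §4 Problem 2] -/
theorem screwWindow_coercive_ratio_four (N M : ℕ) (hNM : M ≤ 4 * (N + 1)) (x : ℕ → ℝ)
    (hx : ∑ m ∈ Ioc N M, x m = 0) :
    (1 / 1000000000000000 : ℝ) / (4 * M) * ∑ m ∈ Ioc N M, x m ^ 2 ≤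
      ∑ m ∈ Ioc N M, ∑ m' ∈ Ioc N M,
        zetaScrewKernel (Real.log m) (Real.log m') * (x m * x m') := by
  rcases le_or_gt M N with hMN | hMN
  · simp [Finset.Ioc_eq_empty_of_le hMN]
  have ha : (0 : ℝ) < 18 / 25 := by norm_num
  have hε := weilGroundEnergy_M72_ge
  -- `L²`-coercivity with the certified constant
  have hcoer : ∀ F : ℝ → ℂ, IsWeilTest F → tsupport F ⊆ Icc (-(18 / 25 : ℝ)) (18 / 25) →
      (1 / 1000000000000000 : ℝ) * ∫ t, ‖F t‖ ^ 2 ≤ (weilQuadratic F).re := by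
    intro F hF hsupp
    have h1 := ConnesVanSuijlekom.weilGroundEnergy_mul_le_re hF hsupp
    have hint : 0 ≤ ∫ t, ‖F t‖ ^ 2 := integral_nonneg fun _ => by positivity
    nlinarith
  refine screwWindow_coercive_of_coercive ha (by norm_num) hcoer N M ?_ x hx
  -- the window: `log M − log(N+1) ≤ log 4 = 2 log 2 < 1.44`
  have hN1 : (0 : ℝ) < (N : ℝ) + 1 := by positivity
  have hMpos : (0 : ℝ) < M := hN1.trans_le (by exact_mod_cast hMN)
  have hM4 : (M : ℝ) ≤ 4 * ((N : ℝ) + 1) := by exact_mod_cast hNM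
  have h1 : Real.log M ≤ Real.log 4 + Real.log ((N : ℝ) + 1) := by
    rw [← Real.log_mul (by norm_num) hN1.ne']
    exact Real.log_le_log hMpos hM4
  have h4 : Real.log 4 = 2 * Real.log 2 := by
    rw [show (4 : ℝ) = 2 ^ 2 by norm_num, Real.log_pow]; norm_num
  have h2 := Real.log_two_lt_d9
  linarith

end Summit.RiemannHypothesis.RiemannHypothesis.Theorems.IntegerScrew

end
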